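import Summits.CriticalPhenomena.Ising3DConformalLimit.Theorems.PrecisionLaplacianDirectCorrelationStableTailPickInversionAux3

/-!
# Pick inversion, auxiliary file 4: weak Stieltjes inversion

Helper file for stub `stub_pickInversion` of line `self-energy-pick-inversion`, crux
`PrecisionLaplacian.DirectCorrelationStableTail` (stmt-CriticalPhenomena-4799). Pure theorem file.

**Weak Stieltjes inversion** (`nevanlinna_measure_Iio_eq_zero`, registered sub-goal
`stub_pickInversion_auxStieltjes`): if a function `H`, continuous on the slit region
`{Im z > 0} ∪ {Re z < 1}` and real on the half-line `(-∞, 1)`, has the Nevanlinna representation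
`H(z) = b + βz + π⁻¹ ∫ (1/(s - z) - s/(1 + s²)) dρ(s)` on the upper half-plane, then its
Nevanlinna measure does not charge `(-∞, 1)`: `ρ((-∞,1)) = 0`. Proof: for `[a, c] ⊂ (-∞, 1)`
and small `ε > 0`, `Im H(x + iε) ≥ π⁻¹ ∫_{[a,c]} ε/((s-x)² + ε²) dρ(s)`; integrating over `x` in a
slightly larger interval and using `∫_{s-r}^{s+r} ε dx/((s-x)²+ε²) = 2 arctan(r/ε) ≥ π/2` gives
`ρ([a,c])/2 ≤ ∫ Im H(x + iε) dx → ∫ Im H(x) dx = 0` (dominated convergence; `H` is bounded near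
the segment). References: Rosenblum–Rovnyak, *Hardy classes and operator theory* (1985), App. §6,
Theorem C; Donoghue (1974), Ch. II.
-/

noncomputable section

namespace Summit.CriticalPhenomena.Ising3DConformalLimit.Cruxes.DirectCorrelationStableTail.SelfEnergyPickInversion

open MeasureTheory Filter Topology Set Real Complex Metric
open scoped BigOperators ComplexConjugate
open Literature.Analysis.Complex

/-! ### The Poisson kernel of the upper half-plane -/

/-- Imaginary part of the Nevanlinna kernel at `z = x + iε`:
`Im (1/(s - z) - s/(1 + s²)) = ε/((s - x)² + ε²)`. [folklore] -/
theorem nevanlinna_kernel_im (s x ε : ℝ) :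
    ((((s : ℂ) - ((x : ℂ) + ε * I))⁻¹ - (s : ℂ) / (1 + (s : ℂ) ^ 2))).im = ε / ((s - x) ^ 2 + ε ^ 2) := by
  have h1 : (s : ℂ) / (1 + (s : ℂ) ^ 2) = ((s / (1 + s ^ 2) : ℝ) : ℂ) := by push_cast; ring
  have h2 : (s : ℂ) - ((x : ℂ) + ε * I) = ((s - x : ℝ) : ℂ) + (-ε : ℝ) * I := by push_cast; ring
  rw [Complex.sub_im, h1, Complex.ofReal_im, sub_zero, h2, Complex.inv_im, Complex.normSq_add_mul_I]
  simp only [Complex.add_im, Complex.ofReal_im, Complex.mul_im, Complex.ofReal_re, Complex.I_im,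
    Complex.I_re, mul_zero, mul_one, zero_add, add_zero]
  ring

/-- `∫_{s-r}^{s+r} ε/((s-x)² + ε²) dx = 2 arctan(r/ε)` (`ε > 0`). [folklore] -/
theorem integral_poissonHalfPlane (s : ℝ) {ε : ℝ} (hε : 0 < ε) (r : ℝ) :
    ∫ x in (s - r)..(s + r), ε / ((s - x) ^ 2 + ε ^ 2) = 2 * Real.arctan (r / ε) := by
  have hderiv : ∀ x ∈ Set.uIcc (s - r) (s + r),
      HasDerivAt (fun x => Real.arctan ((x - s) / ε)) (ε / ((s - x) ^ 2 + ε ^ 2)) x := by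
    intro x _
    have h1 : HasDerivAt (fun x : ℝ => (x - s) / ε) (1 / ε) x := by
      simpa using ((hasDerivAt_id x).sub_const s).div_const ε
    have h2 := (Real.hasDerivAt_arctan ((x - s) / ε)).comp x h1
    refine h2.congr_deriv ?_
    field_simp
    ring
  rw [intervalIntegral.integral_eq_sub_of_hasDerivAt hderiv]
  · simp only [add_sub_cancel_left, sub_sub_cancel_left, neg_div, Real.arctan_neg]
    ring
  · apply Continuous.intervalIntegrable
    exact Continuous.div continuous_const (by fun_prop) fun x => by positivity

/-- The kernel `ε/((s-x)² + ε²)` is at most `1/ε` (`ε > 0`). [folklore] -/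
theorem poissonHalfPlane_le {ε : ℝ} (hε : 0 < ε) (s x : ℝ) : ε / ((s - x) ^ 2 + ε ^ 2) ≤ 1 / ε := by
  rw [div_le_div_iff₀ (by positivity) hε]
  nlinarith [sq_nonneg (s - x)]

/-- The kernel `ε/((s-x)² + ε²)` is nonnegative (`ε > 0`). [folklore] -/
theorem poissonHalfPlane_nonneg {ε : ℝ} (hε : 0 < ε) (s x : ℝ) : 0 ≤ ε / ((s - x) ^ 2 + ε ^ 2) := by
  positivity

/-- A measure integrating `(1 + s²)⁻¹` gives finite mass to bounded intervals. [folklore] -/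
theorem measure_Icc_lt_top_of_integrable {ρ : Measure ℝ}
    (hρ : Integrable (fun s : ℝ => (1 + s ^ 2)⁻¹) ρ) (a c : ℝ) : ρ (Set.Icc a c) < ⊤ := by
  set M : ℝ := 1 + max (a ^ 2) (c ^ 2) with hM
  have hMpos : 0 < M := by positivity
  have hlow : ∀ s ∈ Set.Icc a c, M⁻¹ ≤ (1 + s ^ 2)⁻¹ := by
    intro s hs
    apply inv_anti₀ (by positivity)
    have : s ^ 2 ≤ max (a ^ 2) (c ^ 2) := by
      rcases le_or_gt 0 s with h | h
      · exact le_trans (pow_le_pow_left₀ h hs.2 2) (le_max_right _ _)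
      · have : s ^ 2 ≤ a ^ 2 := by nlinarith [hs.1]
        exact le_trans this (le_max_left _ _)
    linarith
  have h1 : ENNReal.ofReal M⁻¹ * ρ (Set.Icc a c) ≤ ∫⁻ s in Set.Icc a c, ENNReal.ofReal ((1 + s ^ 2)⁻¹) ∂ρ := by
    rw [← setLIntegral_const]
    exact setLIntegral_mono (by fun_prop) fun s hs => ENNReal.ofReal_le_ofReal (hlow s hs)
  have h2 : ∫⁻ s in Set.Icc a c, ENNReal.ofReal ((1 + s ^ 2)⁻¹) ∂ρ < ⊤ :=
    lt_of_le_of_lt (setLIntegral_le_lintegral _ _)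
      ((hasFiniteIntegral_iff_ofReal (ae_of_all _ fun s => by positivity)).1 hρ.2)
  have hne : ENNReal.ofReal M⁻¹ ≠ 0 := by
    rw [ne_eq, ENNReal.ofReal_eq_zero, not_le]; positivity
  refine ENNReal.lt_top_of_mul_ne_top_left ?_ hne
  rw [mul_comm]
  exact ne_top_of_le_ne_top h2.ne h1

/-! ### Weak Stieltjes inversion -/

/-- **Weak Stieltjes inversion.** Let `H` be continuous on the slit region `{Im z > 0} ∪ {Re z < 1}`
and real on the half-line `(-∞, 1)`, with Nevanlinna representation
`H(z) = b + βz + π⁻¹ ∫ (1/(s - z) - s/(1 + s²)) dρ(s)` on the upper half-plane (`β ≥ 0`,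
`∫ dρ/(1 + s²) < ∞`). Then `ρ((-∞, 1)) = 0`. [folklore] -/
theorem nevanlinna_measure_Iio_eq_zero {H : ℂ → ℂ} {b β : ℝ} {ρ : Measure ℝ}
    (hcont : ContinuousOn H {z : ℂ | 0 < z.im ∨ z.re < 1}) (hreal : ∀ x : ℝ, x < 1 → (H x).im = 0)
    (hβ : 0 ≤ β) (hρ : Integrable (fun s : ℝ => (1 + s ^ 2)⁻¹) ρ)
    (hrep : ∀ z ∈ UpperHalfPlane.upperHalfPlaneSet, H z = (b : ℂ) + (β : ℂ) * z +
      (Real.pi : ℂ)⁻¹ * ∫ s : ℝ, (((s : ℂ) - z)⁻¹ - (s : ℂ) / (1 + (s : ℂ) ^ 2)) ∂ρ) :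
    ρ (Set.Iio 1) = 0 := by
  have hπ := Real.pi_pos
  -- reduction to compact intervals `[a, c] ⊂ (-∞, 1)`
  suffices key : ∀ a c : ℝ, a ≤ c → c < 1 → ρ (Set.Icc a c) = 0 by
    have hcover : Set.Iio (1 : ℝ) ⊆ ⋃ n : ℕ, Set.Icc (-(n : ℝ)) (1 - 1 / ((n : ℝ) + 1)) := by
      intro y hy
      rw [Set.mem_Iio] at hy
      obtain ⟨n, hn⟩ := exists_nat_ge (max (-y) (1 / (1 - y)))
      refine Set.mem_iUnion.2 ⟨n, ?_, ?_⟩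
      · linarith [le_max_left (-y) (1 / (1 - y))]
      · have h1 : 1 / (1 - y) ≤ (n : ℝ) + 1 := by linarith [le_max_right (-y) (1 / (1 - y))]
        have h2 : 1 / ((n : ℝ) + 1) ≤ 1 - y := by
          rw [div_le_iff₀ (by positivity)]
          have := (div_le_iff₀ (by linarith : (0 : ℝ) < 1 - y)).1 h1
          linarith
        linarith
    refine measure_mono_null hcover (measure_iUnion_null fun n => key _ _ ?_ ?_)
    · have : (0 : ℝ) < 1 / ((n : ℝ) + 1) := by positivity
      have : 1 / ((n : ℝ) + 1) ≤ 1 := by rw [div_le_one (by positivity)]; linarith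
      linarith
    · have : (0 : ℝ) < 1 / ((n : ℝ) + 1) := by positivity
      linarith
  intro a c hac hc1
  -- the restricted (finite) measure and the geometry
  have hfin : ρ (Set.Icc a c) < ⊤ := measure_Icc_lt_top_of_integrable hρ a c
  set ρ' : Measure ℝ := ρ.restrict (Set.Icc a c) with hρ'
  haveI : IsFiniteMeasure ρ' := ⟨by rw [hρ', Measure.restrict_apply_univ]; exact hfin⟩
  set r₀ : ℝ := (1 - c) / 2 with hr₀
  have hr₀pos : 0 < r₀ := by rw [hr₀]; linarith
  set J : Set ℝ := Set.Icc (a - r₀) (c + r₀) with hJ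
  have hJm : MeasurableSet J := measurableSet_Icc
  have hJlt : ∀ x ∈ J, x < 1 := fun x hx => by rw [hJ] at hx; have := hx.2; rw [hr₀] at this; linarith
  haveI : IsFiniteMeasure (volume.restrict J) := ⟨by
    rw [Measure.restrict_apply_univ, hJ, Real.volume_Icc]; exact ENNReal.ofReal_lt_top⟩
  -- Step 1: pointwise lower bound `π⁻¹ ∫ k dρ' ≤ Im H(x + iε)`
  have hstep1 : ∀ ε : ℝ, 0 < ε → ∀ x : ℝ,
      π⁻¹ * ∫ s, ε / ((s - x) ^ 2 + ε ^ 2) ∂ρ' ≤ (H ((x : ℂ) + ε * I)).im := by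
    intro ε hε x
    have hz : (0 : ℝ) < ((x : ℂ) + ε * I).im := by simpa using hε
    have hK := integrable_nevanlinna_kernel hρ hz
    rw [hrep _ hz]
    have him : ((b : ℂ) + (β : ℂ) * ((x : ℂ) + ε * I) + (Real.pi : ℂ)⁻¹ *
        ∫ s : ℝ, (((s : ℂ) - ((x : ℂ) + ε * I))⁻¹ - (s : ℂ) / (1 + (s : ℂ) ^ 2)) ∂ρ).im =
        β * ε + π⁻¹ * ∫ s, ε / ((s - x) ^ 2 + ε ^ 2) ∂ρ := by
      have h2 := integral_im hK
      simp only [RCLike.im_to_complex, nevanlinna_kernel_im] at h2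
      have hpi : ((Real.pi : ℂ)⁻¹) = ((Real.pi⁻¹ : ℝ) : ℂ) := by push_cast; rfl
      rw [hpi]
      simp only [Complex.add_im, Complex.ofReal_im, Complex.mul_im, Complex.ofReal_re, Complex.I_im,
        Complex.I_re, mul_zero, mul_one, zero_add,
        add_zero, zero_mul, h2]
    rw [him]
    have hmono : ∫ s, ε / ((s - x) ^ 2 + ε ^ 2) ∂ρ' ≤ ∫ s, ε / ((s - x) ^ 2 + ε ^ 2) ∂ρ := by
      refine setIntegral_le_integral ?_ (Eventually.of_forall fun s => poissonHalfPlane_nonneg hε s x)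
      simpa only [RCLike.im_to_complex, nevanlinna_kernel_im] using hK.im
    have : 0 ≤ β * ε := mul_nonneg hβ hε.le
    have hπinv : 0 ≤ π⁻¹ := by positivity
    nlinarith [mul_le_mul_of_nonneg_left hmono hπinv]
  -- Step 2: integrate over `x ∈ J`; Fubini and the arctan integral give `ρ([a,c])/2 ≤ ∫_J Im H`
  have hstep2 : ∀ ε : ℝ, 0 < ε → ε ≤ r₀ →
      (ρ (Set.Icc a c)).toReal / 2 ≤ ∫ x in J, (H ((x : ℂ) + ε * I)).im := by
    intro ε hε hεr
    -- integrability of the kernel on the product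
    have hkcont : Continuous fun p : ℝ × ℝ => ε / ((p.2 - p.1) ^ 2 + ε ^ 2) :=
      Continuous.div continuous_const (by fun_prop) fun p => by positivity
    have hkint : Integrable (Function.uncurry fun (x s : ℝ) => ε / ((s - x) ^ 2 + ε ^ 2))
        ((volume.restrict J).prod ρ') := by
      refine Integrable.mono' (integrable_const (1 / ε)) hkcont.aestronglyMeasurable
        (Eventually.of_forall fun p => ?_)
      obtain ⟨x, s⟩ := p
      simp only [Function.uncurry_apply_pair, Real.norm_eq_abs,
        abs_of_nonneg (poissonHalfPlane_nonneg hε s x)]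
      exact poissonHalfPlane_le hε s x
    -- the `x`-integral of the inner `ρ'`-integral, swapped
    have hswap : ∫ x in J, (∫ s, ε / ((s - x) ^ 2 + ε ^ 2) ∂ρ') =
        ∫ s, (∫ x in J, ε / ((s - x) ^ 2 + ε ^ 2)) ∂ρ' :=
      integral_integral_swap hkint
    -- inner lower bound: `π/2 ≤ ∫_J k(s, x) dx` for `s ∈ [a, c]`
    have hinner : ∀ s ∈ Set.Icc a c, π / 2 ≤ ∫ x in J, ε / ((s - x) ^ 2 + ε ^ 2) := by
      intro s hs
      have hsub : Set.Icc (s - r₀) (s + r₀) ⊆ J := by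
        rw [hJ]; exact Set.Icc_subset_Icc (by linarith [hs.1]) (by linarith [hs.2])
      have hcx : Continuous fun x : ℝ => ε / ((s - x) ^ 2 + ε ^ 2) :=
        Continuous.div continuous_const (by fun_prop) fun x => by positivity
      have h1 : ∫ x in Set.Icc (s - r₀) (s + r₀), ε / ((s - x) ^ 2 + ε ^ 2) ≤
          ∫ x in J, ε / ((s - x) ^ 2 + ε ^ 2) :=
        setIntegral_mono_set (hcx.continuousOn.integrableOn_compact isCompact_Icc)
          (Eventually.of_forall fun x => poissonHalfPlane_nonneg hε s x) (Eventually.of_forall hsub)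
      have h2 : ∫ x in Set.Icc (s - r₀) (s + r₀), ε / ((s - x) ^ 2 + ε ^ 2) = 2 * Real.arctan (r₀ / ε) := by
        rw [integral_Icc_eq_integral_Ioc, ← intervalIntegral.integral_of_le (by linarith),
          integral_poissonHalfPlane s hε r₀]
      have h3 : π / 4 ≤ Real.arctan (r₀ / ε) := by
        rw [← Real.arctan_one]
        exact Real.arctan_strictMono.monotone ((one_le_div hε).2 hεr)
      linarith
    -- assemble
    have hI1 : IntegrableOn (fun x : ℝ => (H ((x : ℂ) + ε * I)).im) J volume := by
      refine ContinuousOn.integrableOn_compact isCompact_Icc ?_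
      refine Complex.continuous_im.comp_continuousOn (hcont.comp (by fun_prop) fun x _ => ?_)
      exact Or.inl (by simpa using hε)
    have hI2 : Integrable (fun x => π⁻¹ * ∫ s, ε / ((s - x) ^ 2 + ε ^ 2) ∂ρ') (volume.restrict J) :=
      (hkint.integral_prod_left).const_mul _
    calc (ρ (Set.Icc a c)).toReal / 2 = π⁻¹ * ∫ s, π / 2 ∂ρ' := by
          rw [MeasureTheory.integral_const, smul_eq_mul, measureReal_def, hρ', Measure.restrict_apply_univ]
          field_simp
        _ ≤ π⁻¹ * ∫ s, (∫ x in J, ε / ((s - x) ^ 2 + ε ^ 2)) ∂ρ' := by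
          refine mul_le_mul_of_nonneg_left ?_ (by positivity)
          refine integral_mono_ae (integrable_const _) hkint.integral_prod_right ?_
          rw [hρ']
          filter_upwards [ae_restrict_mem measurableSet_Icc] with s hs
          exact hinner s hs
        _ = ∫ x in J, π⁻¹ * ∫ s, ε / ((s - x) ^ 2 + ε ^ 2) ∂ρ' := by
          rw [MeasureTheory.integral_const_mul, hswap]
        _ ≤ ∫ x in J, (H ((x : ℂ) + ε * I)).im :=
          setIntegral_mono_on hI2 hI1 hJm fun x _ => hstep1 ε hε x
  -- Step 3: `∫_J Im H(x + iε) dx → ∫_J Im H(x) dx = 0` as `ε ↓ 0`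
  have hlim : Tendsto (fun ε : ℝ => ∫ x in J, (H ((x : ℂ) + ε * I)).im) (𝓝[>] 0)
      (𝓝 (∫ x in J, (H (x : ℂ)).im)) := by
    -- a bound for `H` on the compact `S = J + i[0, r₀]`
    set S : Set ℂ := (fun p : ℝ × ℝ => (p.1 : ℂ) + p.2 * I) '' (J ×ˢ Set.Icc 0 r₀) with hS
    have hSc : IsCompact S := (isCompact_Icc.prod isCompact_Icc).image (by fun_prop)
    have hSU : S ⊆ {z : ℂ | 0 < z.im ∨ z.re < 1} := by
      rintro _ ⟨⟨x, e⟩, ⟨hx, -⟩, rfl⟩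
      exact Or.inr (by simpa using hJlt x hx)
    obtain ⟨C, hC⟩ := hSc.exists_bound_of_continuousOn (hcont.mono hSU)
    have hev : ∀ᶠ ε in 𝓝[>] (0 : ℝ), ε ∈ Set.Ioo 0 r₀ := Ioo_mem_nhdsGT hr₀pos
    refine tendsto_integral_filter_of_dominated_convergence (fun _ => C) ?_ ?_ (integrable_const C) ?_
    · filter_upwards [hev] with ε hε
      refine ContinuousOn.aestronglyMeasurable ?_ hJm
      refine Complex.continuous_im.comp_continuousOn (hcont.comp (by fun_prop) fun x _ => ?_)
      exact Or.inl (by simpa using hε.1)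
    · filter_upwards [hev] with ε hε
      rw [ae_restrict_iff' hJm]
      refine Eventually.of_forall fun x hx => ?_
      refine le_trans (Complex.abs_im_le_norm _) (hC _ ⟨(x, ε), ⟨hx, hε.1.le, hε.2.le⟩, rfl⟩)
    · rw [ae_restrict_iff' hJm]
      refine Eventually.of_forall fun x hx => ?_
      have hxU : (x : ℂ) ∈ {z : ℂ | 0 < z.im ∨ z.re < 1} := Or.inr (by simpa using hJlt x hx)
      have hHx : ContinuousAt H x := hcont.continuousAt (isOpen_slitRegion.mem_nhds hxU)
      have hpath : Tendsto (fun ε : ℝ => (x : ℂ) + ε * I) (𝓝 0) (𝓝 (x : ℂ)) := by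
        have : Continuous fun ε : ℝ => (x : ℂ) + ε * I := by fun_prop
        simpa using this.tendsto 0
      exact ((Complex.continuous_im.tendsto _).comp (hHx.tendsto.comp hpath)).mono_left
        nhdsWithin_le_nhds
  have hzero : ∫ x in J, (H (x : ℂ)).im = 0 := by
    refine setIntegral_eq_zero_of_forall_eq_zero fun x hx => ?_
    exact hreal x (hJlt x hx)
  rw [hzero] at hlim
  -- conclusion
  have hle : (ρ (Set.Icc a c)).toReal / 2 ≤ 0 := by
    refine ge_of_tendsto hlim ?_
    filter_upwards [Ioo_mem_nhdsGT hr₀pos] with ε hε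
    exact hstep2 ε hε.1 hε.2.le
  have htr : (ρ (Set.Icc a c)).toReal = 0 := le_antisymm (by linarith) ENNReal.toReal_nonneg
  rcases (ENNReal.toReal_eq_zero_iff _).1 htr with h | h
  · exact h
  · exact absurd h hfin.ne

/-- **Registered auxiliary stub `stub_pickInversion_auxStieltjes`** (sub-goal of
`stub_pickInversion`): weak Stieltjes inversion for the slit region `{Im z > 0} ∪ {Re z < 1}`
(`nevanlinna_measure_Iio_eq_zero`). [folklore] -/
theorem stub_pickInversion_auxStieltjes : ∀ (H : ℂ → ℂ) (b β : ℝ) (ρ : MeasureTheory.Measure ℝ),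
    ContinuousOn H {z : ℂ | 0 < z.im ∨ z.re < 1} → (∀ x : ℝ, x < 1 → (H x).im = 0) → 0 ≤ β →
    MeasureTheory.Integrable (fun s : ℝ => (1 + s ^ 2)⁻¹) ρ →
    (∀ z ∈ UpperHalfPlane.upperHalfPlaneSet, H z = (b : ℂ) + (β : ℂ) * z +
      (Real.pi : ℂ)⁻¹ * ∫ s : ℝ, (((s : ℂ) - z)⁻¹ - (s : ℂ) / (1 + (s : ℂ) ^ 2)) ∂ρ) →
    ρ (Set.Iio 1) = 0 :=
  fun _ _ _ _ hcont hreal hβ hρ hrep => nevanlinna_measure_Iio_eq_zero hcont hreal hβ hρ hrep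

/-- For `x < 1 ≤ s` and `z` with `Re z = x`, `|Im z| ≤ 1`:
`|1/(s - z) - s/(1 + s²)| ≤ C_x/(1 + s²)` with `C_x = (1 + (|x| + 1)²)/(1 - x) + (|x| + 1)`. [folklore] -/
theorem norm_nevanlinna_kernel_le_of_re_lt {x : ℝ} (hx : x < 1) {s : ℝ} (hs : 1 ≤ s) {z : ℂ}
    (hzre : z.re = x) (hzim : |z.im| ≤ 1) :
    ‖((s : ℂ) - z)⁻¹ - (s : ℂ) / (1 + (s : ℂ) ^ 2)‖ ≤
      ((1 + (|x| + 1) ^ 2) / (1 - x) + (|x| + 1)) * (1 + s ^ 2)⁻¹ := by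
  have hsz : (s : ℂ) ≠ z := by
    intro h; have := congrArg Complex.re h; simp at this; linarith
  rw [nevanlinna_kernel_eq hsz]
  have h1t : (1 + (s : ℂ) ^ 2) = ((1 + s ^ 2 : ℝ) : ℂ) := by push_cast; ring
  have hpos : (0 : ℝ) < 1 + s ^ 2 := by positivity
  have hn1 : ‖(1 + (s : ℂ) ^ 2)⁻¹‖ = (1 + s ^ 2)⁻¹ := by
    rw [h1t, norm_inv, Complex.norm_real, Real.norm_eq_abs, abs_of_pos hpos]
  have hzn : ‖z‖ ≤ |x| + 1 := by
    calc ‖z‖ ≤ |z.re| + |z.im| := Complex.norm_le_abs_re_add_abs_im z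
      _ ≤ |x| + 1 := by rw [hzre]; linarith
  have hn2 : ‖((s : ℂ) - z)⁻¹‖ ≤ (1 - x)⁻¹ := by
    rw [norm_inv]
    apply inv_anti₀ (by linarith)
    have := Complex.abs_re_le_norm ((s : ℂ) - z)
    simp only [sub_re, ofReal_re, hzre] at this
    rw [abs_of_pos (by linarith)] at this
    linarith
  have hx1 : 0 < 1 - x := by linarith
  calc ‖(1 + z ^ 2) * (((s : ℂ) - z)⁻¹ * (1 + (s : ℂ) ^ 2)⁻¹) + z * (1 + (s : ℂ) ^ 2)⁻¹‖
      ≤ ‖(1 + z ^ 2) * (((s : ℂ) - z)⁻¹ * (1 + (s : ℂ) ^ 2)⁻¹)‖ + ‖z * (1 + (s : ℂ) ^ 2)⁻¹‖ :=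
        norm_add_le _ _
    _ = ‖1 + z ^ 2‖ * (‖((s : ℂ) - z)⁻¹‖ * (1 + s ^ 2)⁻¹) + ‖z‖ * (1 + s ^ 2)⁻¹ := by
        rw [norm_mul, norm_mul, norm_mul, hn1]
    _ ≤ (1 + (|x| + 1) ^ 2) * ((1 - x)⁻¹ * (1 + s ^ 2)⁻¹) + (|x| + 1) * (1 + s ^ 2)⁻¹ := by
        have h1 : ‖1 + z ^ 2‖ ≤ 1 + (|x| + 1) ^ 2 := by
          calc ‖1 + z ^ 2‖ ≤ ‖(1 : ℂ)‖ + ‖z ^ 2‖ := norm_add_le _ _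
            _ = 1 + ‖z‖ ^ 2 := by rw [norm_one, norm_pow]
            _ ≤ 1 + (|x| + 1) ^ 2 := by gcongr
        gcongr
    _ = ((1 + (|x| + 1) ^ 2) / (1 - x) + (|x| + 1)) * (1 + s ^ 2)⁻¹ := by
        rw [div_eq_mul_inv]; ring


end Summit.CriticalPhenomena.Ising3DConformalLimit.Cruxes.DirectCorrelationStableTail.SelfEnergyPickInversion

end
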